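import Literature.MathematicalPhysics.QuantumFieldTheory.Balaban1983to89.B8TorusShiftStencils

/-!
# `Balaban1983to89.B8TorusShiftAveraging` — translation covariance of the BLOCK-RECURSIVE objects of [Balaban1985RegularSpaces] §1 on `ℤᵈ`:
# the covariant block averaging of gauge transformations `R̄_j(U₀)u` ((79)–(80) of [3] = [Balaban1985Averaging]) and the restriction (1.29)
# «(R̄₀uʲ)(y) = 1, y ∈ Λ_j» for the torus constraint sequence `torusLam k` — a translation of the fine lattice by `Lʲw` is a translation of the
# `j`-lattice by `w` (module M1b-R of the periodicity joint of the [B8] §3 Theorem-2 torus supplier, sub-row «G-B8-T2S», `lit-balaban-p33/T2S-MAP.md`)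

statement-level skeleton of published theorems with citation tags; proofs where landed; nothing here is a claim about the
Yang–Mills mass gap

T. Bałaban, *Spaces of regular gauge field configurations on a lattice and gauge fixing conditions*, Commun. Math. Phys. **99** (1985) 75–102
`[Balaban1985RegularSpaces]` ((1.29) p. 81, (1.15)–(1.18) p. 78); T. Bałaban, *Averaging operations for lattice gauge theories*, Commun. Math. Phys.
**98** (1985) 17–51 `[Balaban1985Averaging]` ((78)–(80) p. 30, (43) p. 24); [Balaban1987RG1] (4.16) p. 285 («translation invariant»).

CITATION HEADER (lean-in-tree rule).  Cell `lit-balaban`, seat `lit-balaban-p33` (gen 90), sub-row «G-B8-T2S», module M1b-R.  WHAT IS PROVED (kernel,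
0 sorry, theorems only): `avgStep_blockSites_shift` (the one-step average (78)∕(80) over the block `B(y + w)` is the average over `B(y)` of the
translated data), `bgT_shiftCfg` (the block transporters (79) of a translated background), **`Rbar_bgT_shiftCfg`** (`R̄_j(t_{Lʲw}U₀)(t_{Lʲw}u)(y) =
R̄_j(U₀)u(y + w)`, induction on `j` with `B7TranslationCovariance.shiftCfg_avgIter` and `B12Ineq417Flat.hol_shiftCfg`), **`restr129_torusLam_shiftCfg`**
((1.29) for `Λ = torusLam k` is invariant under `(U₀, u) ↦ (t_{Lᵏw}U₀, t_{Lᵏw}u)`).  Elementary bookkeeping on the tree's concrete objects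
(`B7Eq78Linearization.Rbar`∕`zdBlocking`, `B8Eq119TwistedAxial.bgT`∕`Restr129`); nothing of Theorem 2 is proved here; `T_η ↦ ℤᵈ`; count-neutral;
nothing continuum ∕ ℝ⁴ ∕ OS ∕ mass-gap ∕ Clay.
-/

noncomputable section

open NormedSpace
open scoped BigOperators

namespace Literature.MathematicalPhysics.QuantumFieldTheory.Balaban1983to89.B8TorusShiftAveraging

open Literature.MathematicalPhysics.QuantumLattice (blockSites blockBase)
open B7Prop1Explicit (e hol treeWord axialFn boxVec)
open B7Prop2Explicit (avgIter)
open B7Eq78Linearization (conjR Rbar Rbar_succ Rbar_zero zdBlocking avgStep)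
open B7BlockAvgLog (barAvg)
open B8Eq119TwistedAxial (bgT Restr129 blockBase_eq_smul)
open B8Thm4TorusAt (torusLam mem_torusLam_iff)
open B7TranslationCovariance (shiftCfg_avgIter)
open B12Ineq417Flat (shiftCfg shiftCfg_apply hol_shiftCfg)

-- the `ℤ^d` sites of `B7Prop1Explicit` are `LSite` here (convention of `B8Thm2TorusAt`).
open B7Prop1Explicit renaming Site → LSite

variable {d : ℕ}

section Averaging

variable {𝔸 : Type*} [NormedRing 𝔸] [NormedAlgebra ℂ 𝔸] [CompleteSpace 𝔸]

omit [CompleteSpace 𝔸] in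
/-- A block sum as a sum over the offsets `t ∈ [0, M)ᵈ` (unfolding of `QuantumLattice.blockSites`). [cite: Balaban1985Averaging, (43) p.24 (blocks `B(y)`)] -/
private theorem sum_blockSites_eq {β : Type*} [AddCommMonoid β] (M : ℕ) (y : LSite d) (g : LSite d → β) :
    ∑ x ∈ blockSites M y, g x = ∑ t ∈ Fintype.piFinset (fun _ : Fin d => Finset.range M), g (blockBase M y + fun i => (t i : ℤ)) := by
  unfold blockSites
  rw [Finset.sum_image]
  intro t _ t' _ h
  funext i
  have hi := congrFun h i
  simpa using hi

omit [CompleteSpace 𝔸] in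
/-- **Sums over a translated block**: `Σ_{x ∈ B(y + w)} g(x) = Σ_{x ∈ B(y)} g(x + Lw)` (the block of `y + w` is the translate by `Lw` of the block of
`y`). [cite: Balaban1985Averaging, (43) p.24 (blocks `B(y)`); Balaban1987RG1, (4.16) p.285] -/
theorem sum_blockSites_add {β : Type*} [AddCommMonoid β] (L : ℕ) (y w : LSite d) (g : LSite d → β) :
    ∑ x ∈ blockSites L (y + w), g x = ∑ x ∈ blockSites L y, g (x + (L : ℤ) • w) := by
  rw [sum_blockSites_eq, sum_blockSites_eq]
  refine Finset.sum_congr rfl fun t _ => ?_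
  rw [blockBase_eq_smul, blockBase_eq_smul, smul_add, add_right_comm]

omit [CompleteSpace 𝔸] in
/-- **The one-step covariant average (78)∕(80) over `B(y + w)` is the average over `B(y)` of the data translated by `Lw`** (uniform weights).
[cite: Balaban1985Averaging, (78)–(80) p.30; Balaban1987RG1, (4.16) p.285] -/
theorem avgStep_blockSites_shift (L : ℕ) (y w : LSite d) (c : ℝ) (T : LSite d → 𝔸ˣ) (vy : 𝔸) (v : LSite d → 𝔸) :
    avgStep (blockSites L y) (fun _ => c) (fun x => T (x + (L : ℤ) • w)) vy (fun x => v (x + (L : ℤ) • w)) =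
      avgStep (blockSites L (y + w)) (fun _ => c) T vy v := by
  unfold avgStep barAvg
  rw [sum_blockSites_add]

/-- **The block transporters (79) of a translated background**: `T_j(t_{Lʲ(Lw)}U₀)(y, x) = T_j(U₀)(y + w, x + Lw)` (the `j`-th average of the
translated background is the translate of the `j`-th average, `B7TranslationCovariance.shiftCfg_avgIter`; the tree holonomy from the corner
`L(y + w) = Ly + Lw`). [cite: Balaban1985Averaging, (79) p.30, (43) p.24; Balaban1987RG1, (4.16) p.285] -/
theorem bgT_shiftCfg (L : ℕ) (U₀ : LSite d → Fin d → 𝔸ˣ) (j : ℕ) (w y x : LSite d) :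
    bgT L (shiftCfg (((L : ℤ) ^ j) • ((L : ℤ) • w)) U₀) j y x = bgT L U₀ j (y + w) (x + (L : ℤ) • w) := by
  unfold bgT axialFn
  rw [← shiftCfg_avgIter, hol_shiftCfg, blockBase_eq_smul, blockBase_eq_smul, smul_add]
  congr 2
  abel

/-- **`R̄_j` OF TRANSLATED DATA** ((79)–(80) of [3], `B7Eq78Linearization.Rbar` for the `ℤᵈ` blocking and the background transporters `bgT`):
translating the background and the gauge function on the fine lattice by `Lʲw` translates `R̄_j(U₀)u` on the `j`-lattice by `w`:
`R̄_j(t_{Lʲw}U₀)(t_{Lʲw}u)(y) = (R̄_j(U₀)u)(y + w)`. [cite: Balaban1985Averaging, (79)–(80) p.30; Balaban1985RegularSpaces, (1.15)–(1.18) p.78; Balaban1987RG1, (4.16) p.285] -/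
theorem Rbar_bgT_shiftCfg (L : ℕ) (U₀ : LSite d → Fin d → 𝔸ˣ) :
    ∀ (j : ℕ) (w : LSite d) (u : LSite d → 𝔸) (y : LSite d),
      Rbar (zdBlocking d L) (bgT L (shiftCfg (((L : ℤ) ^ j) • w) U₀)) j (shiftCfg (((L : ℤ) ^ j) • w) u) y =
        Rbar (zdBlocking d L) (bgT L U₀) j u (y + w)
  | 0, w, u, y => by simp [shiftCfg_apply]
  | j + 1, w, u, y => by
      have hv : ((L : ℤ) ^ (j + 1)) • w = ((L : ℤ) ^ j) • ((L : ℤ) • w) := by rw [pow_succ, mul_smul]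
      rw [hv, Rbar_succ, Rbar_succ]
      have IH : ∀ y', Rbar (zdBlocking d L) (bgT L (shiftCfg (((L : ℤ) ^ j) • ((L : ℤ) • w)) U₀)) j
          (shiftCfg (((L : ℤ) ^ j) • ((L : ℤ) • w)) u) y' = Rbar (zdBlocking d L) (bgT L U₀) j u (y' + (L : ℤ) • w) :=
        fun y' => Rbar_bgT_shiftCfg L U₀ j ((L : ℤ) • w) u y'
      have IHf : Rbar (zdBlocking d L) (bgT L (shiftCfg (((L : ℤ) ^ j) • ((L : ℤ) • w)) U₀)) j
          (shiftCfg (((L : ℤ) ^ j) • ((L : ℤ) • w)) u) = fun x => Rbar (zdBlocking d L) (bgT L U₀) j u (x + (L : ℤ) • w) :=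
        funext IH
      have hT : bgT L (shiftCfg (((L : ℤ) ^ j) • ((L : ℤ) • w)) U₀) j y = fun x => bgT L U₀ j (y + w) (x + (L : ℤ) • w) :=
        funext fun x => bgT_shiftCfg L U₀ j w y x
      show avgStep (blockSites L y) (fun _ => ((L : ℝ) ^ d)⁻¹) _ _ _ = avgStep (blockSites L (y + w)) (fun _ => ((L : ℝ) ^ d)⁻¹) _ _ _
      rw [IHf, hT]
      show avgStep (blockSites L y) (fun _ => ((L : ℝ) ^ d)⁻¹) (fun x => bgT L U₀ j (y + w) (x + (L : ℤ) • w))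
          (Rbar (zdBlocking d L) (bgT L U₀) j u (blockBase L y + (L : ℤ) • w))
          (fun x => Rbar (zdBlocking d L) (bgT L U₀) j u (x + (L : ℤ) • w)) =
        avgStep (blockSites L (y + w)) (fun _ => ((L : ℝ) ^ d)⁻¹) (bgT L U₀ j (y + w))
          (Rbar (zdBlocking d L) (bgT L U₀) j u (blockBase L (y + w))) (Rbar (zdBlocking d L) (bgT L U₀) j u)
      have hb : blockBase L y + (L : ℤ) • w = blockBase L (y + w) := by
        rw [blockBase_eq_smul, blockBase_eq_smul, smul_add]
      rw [hb]
      exact avgStep_blockSites_shift L y w _ (bgT L U₀ j (y + w)) _ (Rbar (zdBlocking d L) (bgT L U₀) j u)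

/-- **(1.29) FOR `Λ = torusLam k` IS TRANSLATION INVARIANT**: if `(R̄₀uʲ)(y) = 1` at every site of the top lattice for `(U₀, u)`, then also for the
pair translated by `Lᵏw` on the fine lattice (no constraint below the top level). [cite: Balaban1985RegularSpaces, (1.29) p.81, (1.28) p.81, p.77 («Ω_j = T_η»)] -/
theorem restr129_torusLam_shiftCfg (L k : ℕ) (U₀ : LSite d → Fin d → 𝔸ˣ) (u : LSite d → 𝔸ˣ) (w : LSite d)
    (h : Restr129 L k (torusLam k) U₀ u) :
    Restr129 L k (torusLam k) (shiftCfg (((L : ℤ) ^ k) • w) U₀) (shiftCfg (((L : ℤ) ^ k) • w) u) := by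
  intro j hj y hy
  have hjk : j = k := (mem_torusLam_iff k j y).1 hy
  subst hjk
  have hc : (fun x => ((shiftCfg (((L : ℤ) ^ j) • w) u x : 𝔸ˣ) : 𝔸)) = shiftCfg (((L : ℤ) ^ j) • w) (fun x => ((u x : 𝔸ˣ) : 𝔸)) := rfl
  rw [hc, Rbar_bgT_shiftCfg]
  exact h j hj (y + w) ((mem_torusLam_iff j j (y + w)).2 rfl)

end Averaging

#print axioms Rbar_bgT_shiftCfg
#print axioms restr129_torusLam_shiftCfg

end Literature.MathematicalPhysics.QuantumFieldTheory.Balaban1983to89.B8TorusShiftAveraging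

end
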